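import Mathlib.RingTheory.MvPolynomial.Basic
import Mathlib.Algebra.MvPolynomial.PDeriv
import Literature.AlgebraicGeometry.Resolution.RegularLocalRingsProofs
import Literature.AlgebraicGeometry.Resolution.AffineDomainEquidim
import Literature.AlgebraicGeometry.Resolution.AffineEquidimensionalIdeals
import Literature.RingTheory.Localization.MinimalPrimesLocalization
import HarnessLib

/-!
# The Jacobian criterion at a rational point: smoothness and a unique irreducible component

Let `k` be a field, `A = k[Y_1, …, Y_m]`, `y ∈ k^m` with point ideal `𝔪_y = ker (ev_y)`, and
`I ⊆ P ⊆ 𝔪_y` ideals with `P` prime. Suppose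

* (Jacobian) `f_1, …, f_r ∈ I` have linearly independent gradients `∇f_i(y) ∈ k^m`, and
* (dimension) `dim A/P ≥ m - r`.

Then `I A_{𝔪_y} = P A_{𝔪_y} = (f_1, …, f_r) A_{𝔪_y}`, the local ring `A_{𝔪_y}/I A_{𝔪_y}` is a
regular local ring of dimension `m - r` (the point `y` is a smooth point of `V(I)`), and `P` is the
UNIQUE minimal prime of `I` contained in `𝔪_y` (the point lies on exactly one irreducible
component of `V(I)`, namely `V(P)`). This is the affine Jacobian criterion (Hartshorne, *Algebraic
Geometry*, Thm. I.5.1 and its proof: `𝔪/𝔪² ≅ k^m` dually to gradients at `y`, so the `f_i` are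
part of a regular system of parameters of the regular local ring `A_{𝔪_y}`; Matsumura, Thm. 14.2:
the quotient by part of a regular system of parameters is regular of the complementary dimension;
Thm. 14.3: regular local rings are domains; the prime `P A_𝔪 / (f)` of the `(m-r)`-dimensional
domain `A_𝔪/(f)` has coheight `dim A/P ≥ m - r`, hence is zero).

* `eval_pderiv_eq_zero_of_mem_sq` — gradients at `y` vanish on `𝔪_y²`;
* `eval_pderiv_eq_zero_of_map_mem_sq` — and on elements of `𝔪_y` whose image lies in
  `(𝔪_y A_{𝔪_y})²`;
* `linearIndependent_toCotangent_of_jacobian` — independent gradients give independent classes in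
  the cotangent space `𝔪 A_𝔪 / (𝔪 A_𝔪)²`;
* `eq_span_of_isPrime_of_linearIndependent_toCotangent` — in a regular local ring, a prime
  containing part `S` of a regular system of parameters with `dim R ≤ dim R/P + #S` is `(S)`, and
  `R/(S)` is regular of dimension `dim R - #S` (Matsumura 14.2, 14.3);
* `map_eq_map_of_jacobian` — **`I A_𝔪 = P A_𝔪`, regular of dimension `m - r`**;
* `existsUnique_minimalPrimes_le_of_jacobian` (and `…_le_ker_aeval_…`) — **exactly one minimal
  prime of `I` lies inside `𝔪_y`**; `mem_minimalPrimes_of_jacobian` — it is `P`.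

Motivation (route `ValiantsHypothesis/LangWeilTransfer`, crux `ShatteringExclusion`, line `birth`
v2): the certificate "the constant vector of a circuit lies on exactly one component of its
constants variety" (`Unibranching ⇒ FewBranches`) becomes CHECKABLE for explicit circuits: exhibit
`r` coefficient identities with independent gradients at the constant vector and a prime (e.g. the
ideal of the gauge-orbit closure) of the complementary dimension.

## References
* R. Hartshorne, *Algebraic Geometry*, GTM 52, Springer 1977, Ch. I §5, Thm. 5.1. [Hartshorne1977]
* H. Matsumura, *Commutative Ring Theory*, CUP 1986, Thms. 14.2, 14.3. [Matsumura1987]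
-/

noncomputable section

open MvPolynomial IsLocalRing

namespace Literature.RingTheory.MvPolynomial

universe u

variable {k : Type u} [Field k] {m : ℕ}

/-! ### Gradients at a point vanish on `𝔪_y²` -/

/-- The gradient at `y` of an element of `𝔪_y² = ker(ev_y)²` vanishes (Leibniz rule).
[cite: Hartshorne1977, Thm. I.5.1 (proof)] -/
theorem eval_pderiv_eq_zero_of_mem_sq (y : Fin m → k) {g : MvPolynomial (Fin m) k}
    (hg : g ∈ (RingHom.ker (MvPolynomial.eval y)) ^ 2) (j : Fin m) :
    MvPolynomial.eval y (MvPolynomial.pderiv j g) = 0 := by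
  rw [pow_two] at hg
  refine Submodule.mul_induction_on hg (fun a ha b hb => ?_) (fun u v hu hv => ?_)
  · rw [RingHom.mem_ker] at ha hb
    rw [(MvPolynomial.pderiv j).leibniz, smul_eq_mul, smul_eq_mul, map_add, map_mul, map_mul,
      ha, hb, zero_mul, zero_mul, add_zero]
  · rw [map_add, map_add, hu, hv, add_zero]

/-- The point ideal `𝔪_y = ker (ev_y)` is maximal. [folklore] -/
private theorem ker_eval_isMaximal (y : Fin m → k) :
    (RingHom.ker (MvPolynomial.eval y)).IsMaximal :=
  RingHom.ker_isMaximal_of_surjective _ fun c => ⟨C c, by simp⟩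

/-- If `g ∈ 𝔪_y` and the image of `g` in `A_{𝔪_y}` lies in `(𝔪_y A_{𝔪_y})²`, then the gradient
of `g` at `y` vanishes: clearing denominators, `u g ∈ 𝔪_y²` for some `u` with `u(y) ≠ 0`, and
`∇(u g)(y) = u(y) ∇g(y)`. [cite: Hartshorne1977, Thm. I.5.1 (proof)] -/
theorem eval_pderiv_eq_zero_of_map_mem_sq (y : Fin m → k)
    [h𝔪 : (RingHom.ker (MvPolynomial.eval y)).IsPrime] {g : MvPolynomial (Fin m) k}
    (hgy : g ∈ RingHom.ker (MvPolynomial.eval y))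
    (hg : algebraMap (MvPolynomial (Fin m) k) (Localization.AtPrime (RingHom.ker (MvPolynomial.eval y))) g ∈
      (maximalIdeal (Localization.AtPrime (RingHom.ker (MvPolynomial.eval y)))) ^ 2) (j : Fin m) :
    MvPolynomial.eval y (MvPolynomial.pderiv j g) = 0 := by
  set 𝔪 := RingHom.ker (MvPolynomial.eval y) with h𝔪def
  rw [← Localization.AtPrime.map_eq_maximalIdeal, ← Ideal.map_pow,
    IsLocalization.mem_map_algebraMap_iff 𝔪.primeCompl (Localization.AtPrime 𝔪)] at hg
  obtain ⟨⟨⟨g', hg'⟩, ⟨u, hu⟩⟩, hgu⟩ := hg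
  -- `g u = g'` in `A`
  have hinj : Function.Injective (algebraMap (MvPolynomial (Fin m) k) (Localization.AtPrime 𝔪)) :=
    IsLocalization.injective (Localization.AtPrime 𝔪) (Ideal.primeCompl_le_nonZeroDivisors 𝔪)
  have heq : g * u = g' := by
    apply hinj
    rw [map_mul]
    exact hgu
  have h1 : MvPolynomial.eval y (MvPolynomial.pderiv j (g * u)) = 0 := by
    rw [heq]; exact eval_pderiv_eq_zero_of_mem_sq y hg' j
  rw [(MvPolynomial.pderiv j).leibniz, smul_eq_mul, smul_eq_mul, map_add, map_mul, map_mul,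
    RingHom.mem_ker.1 hgy, zero_mul, zero_add] at h1
  have huy : MvPolynomial.eval y u ≠ 0 := fun h => hu (RingHom.mem_ker.2 h)
  exact (mul_eq_zero.1 h1).resolve_left huy

/-- `A_{𝔪_y} = k + 𝔪_y A_{𝔪_y}`: every element of the local ring at a rational point differs from
a scalar by an element of the maximal ideal (its "value at `y`"). [folklore] -/
private theorem exists_sub_algebraMap_mem_maximalIdeal (y : Fin m → k)
    [h𝔪 : (RingHom.ker (MvPolynomial.eval y)).IsPrime]
    (c : Localization.AtPrime (RingHom.ker (MvPolynomial.eval y))) :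
    ∃ c₀ : k, c - algebraMap k _ c₀ ∈
      maximalIdeal (Localization.AtPrime (RingHom.ker (MvPolynomial.eval y))) := by
  obtain ⟨⟨a, s⟩, hc⟩ := IsLocalization.mk'_surjective (RingHom.ker (MvPolynomial.eval y)).primeCompl c
  simp only at hc
  have hs : MvPolynomial.eval y (s : MvPolynomial (Fin m) k) ≠ 0 := fun h => s.2 (RingHom.mem_ker.2 h)
  refine ⟨MvPolynomial.eval y a / MvPolynomial.eval y s, ?_⟩
  set c₀ := MvPolynomial.eval y a / MvPolynomial.eval y s with hc₀
  -- multiply by the unit `s/1`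
  have hunit : IsUnit (algebraMap (MvPolynomial (Fin m) k)
      (Localization.AtPrime (RingHom.ker (MvPolynomial.eval y))) s) :=
    IsLocalization.map_units _ s
  rw [← Ideal.unit_mul_mem_iff_mem _ hunit, mul_sub, ← hc, IsLocalization.mk'_spec',
    IsScalarTower.algebraMap_apply k (MvPolynomial (Fin m) k)
      (Localization.AtPrime (RingHom.ker (MvPolynomial.eval y))) c₀, ← map_mul, ← map_sub,
    ← Localization.AtPrime.map_eq_maximalIdeal]
  apply Ideal.mem_map_of_mem
  rw [RingHom.mem_ker, map_sub, map_mul, MvPolynomial.algebraMap_eq, MvPolynomial.eval_C, hc₀,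
    mul_div_cancel₀ _ hs, sub_self]

/-! ### Independent gradients give independent cotangent classes -/

/-- **Independent gradients at `y` give linearly independent classes in the cotangent space
`𝔪 A_𝔪/(𝔪 A_𝔪)²` of the local ring at `y`** (`𝔪/𝔪²` is dual to the space of gradients at a
rational point): if `f_1, …, f_r ∈ 𝔪_y` have linearly independent gradients at `y`, the images in
`A_{𝔪_y}` of the `f_i` form a finite set `S ⊆ 𝔪 A_{𝔪_y}` whose cotangent classes are linearly
independent over the residue field — hypothesis (2) of Matsumura's Thm. 14.2.
[cite: Hartshorne1977, Thm. I.5.1 (proof)] -/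
theorem linearIndependent_toCotangent_of_jacobian (y : Fin m → k)
    [h𝔪 : (RingHom.ker (MvPolynomial.eval y)).IsPrime] {r : ℕ}
    (f : Fin r → MvPolynomial (Fin m) k) (hfy : ∀ i, f i ∈ RingHom.ker (MvPolynomial.eval y))
    (hjac : LinearIndependent k (fun i : Fin r => fun j : Fin m =>
      MvPolynomial.eval y (MvPolynomial.pderiv j (f i))))
    {S : Finset (Localization.AtPrime (RingHom.ker (MvPolynomial.eval y)))}
    (hS : ∀ x, x ∈ S ↔ ∃ i, algebraMap (MvPolynomial (Fin m) k)
      (Localization.AtPrime (RingHom.ker (MvPolynomial.eval y))) (f i) = x)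
    (sub : (S : Set (Localization.AtPrime (RingHom.ker (MvPolynomial.eval y)))) ⊆
      maximalIdeal (Localization.AtPrime (RingHom.ker (MvPolynomial.eval y)))) :
    LinearIndependent (ResidueField (Localization.AtPrime (RingHom.ker (MvPolynomial.eval y))))
      ((⇑(maximalIdeal (Localization.AtPrime (RingHom.ker (MvPolynomial.eval y)))).toCotangent) ∘
        Set.inclusion sub) := by
  classical
  set 𝔪 := RingHom.ker (MvPolynomial.eval y) with h𝔪def
  -- index of each element of `S`
  have hidx : ∀ x : (S : Set (Localization.AtPrime 𝔪)), ∃ i,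
      algebraMap (MvPolynomial (Fin m) k) (Localization.AtPrime 𝔪) (f i) = x.1 :=
    fun x => (hS x.1).1 (Finset.mem_coe.1 x.2)
  choose idx hidx using hidx
  have hidx_inj : Function.Injective idx := by
    intro x x' h
    apply Subtype.ext
    rw [← hidx x, ← hidx x', h]
  -- the gradients of the `f (idx x)` are linearly independent
  have hli : LinearIndependent k (fun x : (S : Set (Localization.AtPrime 𝔪)) => fun j : Fin m =>
      MvPolynomial.eval y (MvPolynomial.pderiv j (f (idx x)))) := hjac.comp idx hidx_inj
  rw [linearIndependent_iff']
  intro t g hsum x hx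
  -- lift the coefficients to scalars of `k` modulo the maximal ideal
  have hlift : ∀ x : (S : Set (Localization.AtPrime 𝔪)), ∃ c₀ : k,
      IsLocalRing.residue (Localization.AtPrime 𝔪) (algebraMap k (Localization.AtPrime 𝔪) c₀) = g x := by
    intro x
    obtain ⟨a, ha⟩ := Ideal.Quotient.mk_surjective (g x)
    obtain ⟨c₀, hc₀⟩ := exists_sub_algebraMap_mem_maximalIdeal y a
    refine ⟨c₀, ?_⟩
    rw [← ha]
    change IsLocalRing.residue _ _ = IsLocalRing.residue _ a
    rw [eq_comm, ← sub_eq_zero, ← map_sub, IsLocalRing.residue_eq_zero_iff]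
    exact hc₀
  choose c₀ hc₀ using hlift
  -- the relation says `Σ c₀ x • f (idx x)` maps into `(𝔪 A_𝔪)²`
  set G : MvPolynomial (Fin m) k := ∑ x ∈ t, c₀ x • f (idx x) with hG
  have hGy : G ∈ 𝔪 := by
    refine Ideal.sum_mem _ fun x _ => ?_
    rw [Algebra.smul_def]
    exact Ideal.mul_mem_left _ _ (hfy (idx x))
  have hGsq : algebraMap (MvPolynomial (Fin m) k) (Localization.AtPrime 𝔪) G ∈
      (maximalIdeal (Localization.AtPrime 𝔪)) ^ 2 := by
    have h1 : (∑ x ∈ t, g x • ((maximalIdeal (Localization.AtPrime 𝔪)).toCotangent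
        (Set.inclusion sub x))) =
        (maximalIdeal (Localization.AtPrime 𝔪)).toCotangent
          (∑ x ∈ t, algebraMap k (Localization.AtPrime 𝔪) (c₀ x) • Set.inclusion sub x) := by
      rw [map_sum]
      refine Finset.sum_congr rfl fun x _ => ?_
      rw [map_smul, ← hc₀ x]
      rfl
    have h2 : (∑ x ∈ t, algebraMap k (Localization.AtPrime 𝔪) (c₀ x) • Set.inclusion sub x) ∈
        LinearMap.ker (maximalIdeal (Localization.AtPrime 𝔪)).toCotangent := by
      rw [LinearMap.mem_ker, ← h1]
      exact hsum
    rw [Ideal.mem_toCotangent_ker] at h2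
    have h3 : ((∑ x ∈ t, algebraMap k (Localization.AtPrime 𝔪) (c₀ x) • Set.inclusion sub x :
        maximalIdeal (Localization.AtPrime 𝔪)) : Localization.AtPrime 𝔪) =
        algebraMap (MvPolynomial (Fin m) k) (Localization.AtPrime 𝔪) G := by
      rw [hG, map_sum, Submodule.coe_sum]
      refine Finset.sum_congr rfl fun x _ => ?_
      rw [Submodule.coe_smul, smul_eq_mul, Algebra.smul_def, map_mul,
        ← IsScalarTower.algebraMap_apply k (MvPolynomial (Fin m) k) (Localization.AtPrime 𝔪),
        hidx x]
    rw [← h3]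
    exact h2
  -- hence all gradients of `G` vanish: a linear relation among the `∇ f (idx x)`
  have hgrad : ∑ x ∈ t, c₀ x • (fun j : Fin m =>
      MvPolynomial.eval y (MvPolynomial.pderiv j (f (idx x)))) = 0 := by
    funext j
    have hj := eval_pderiv_eq_zero_of_map_mem_sq y hGy hGsq j
    rw [hG, map_sum, map_sum] at hj
    rw [Finset.sum_apply, Pi.zero_apply, ← hj]
    refine Finset.sum_congr rfl fun x _ => ?_
    rw [Pi.smul_apply, smul_eq_mul, Derivation.map_smul, MvPolynomial.smul_eval]
  have hc : c₀ x = 0 := (linearIndependent_iff'.1 hli) t c₀ hgrad x hx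
  rw [← hc₀ x, hc, map_zero, map_zero]

/-! ### Regular local rings: a prime containing part of a regular system of parameters -/

/-- **A prime containing part of a regular system of parameters, of the complementary coheight,
is generated by it.** Let `R` be a regular local ring, `S ⊆ 𝔪` a finite set whose classes in
`𝔪/𝔪²` are linearly independent, and `P ⊇ (S)` a prime ideal with `dim R ≤ dim R/P + #S`. Then
`P = (S)`, and `R/(S)` is a regular local ring with `dim R/(S) + #S = dim R`. (Matsumura Thm. 14.2:
`R/(S)` is regular of dimension `dim R - #S`; Thm. 14.3: it is a domain; a NONZERO prime `Q` of a
local domain `D` has `dim D/Q < dim D` — here `dim D/Q + 1 ≤ dim D/(x) + 1 = dim D` for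
`0 ≠ x ∈ Q`.) [cite: Matsumura1987, Thm. 14.2] -/
theorem eq_span_of_isPrime_of_linearIndependent_toCotangent {R : Type u} [CommRing R]
    [IsRegularLocalRing R] (S : Finset R) (sub : (S : Set R) ⊆ maximalIdeal R)
    (hli : LinearIndependent (ResidueField R) ((⇑(maximalIdeal R).toCotangent) ∘ Set.inclusion sub))
    {P : Ideal R} [hP : P.IsPrime] (hSP : Ideal.span (S : Set R) ≤ P)
    (hdim : ringKrullDim R ≤ ringKrullDim (R ⧸ P) + S.card) :
    P = Ideal.span (S : Set R) ∧ IsRegularLocalRing (R ⧸ Ideal.span (S : Set R)) ∧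
      ringKrullDim (R ⧸ Ideal.span (S : Set R)) + S.card = ringKrullDim R := by
  classical
  obtain ⟨hreg, hdimS⟩ :=
    ((Literature.AlgebraicGeometry.Resolution.quotient_isRegularLocalRing_tfae R S sub).out 1 2).mp hli
  refine ⟨?_, hreg, hdimS⟩
  haveI := hreg
  haveI : IsDomain (R ⧸ Ideal.span (S : Set R)) :=
    Literature.AlgebraicGeometry.Resolution.isDomain_of_isRegularLocalRing (R ⧸ Ideal.span (S : Set R))
  obtain ⟨n, hn⟩ :=
    Literature.AlgebraicGeometry.Resolution.ringKrullDim_eq_nat (R ⧸ Ideal.span (S : Set R))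
  have hR : ringKrullDim R = (n : WithBot ℕ∞) + S.card := by rw [← hdimS, hn]
  -- `dim R/P` is a natural number `q`
  haveI : Nontrivial (R ⧸ P) := Ideal.Quotient.nontrivial_iff.mpr hP.ne_top'
  haveI : IsLocalRing (R ⧸ P) :=
    IsLocalRing.of_surjective' (Ideal.Quotient.mk P) Ideal.Quotient.mk_surjective
  obtain ⟨q, hq⟩ := Literature.AlgebraicGeometry.Resolution.ringKrullDim_eq_nat (R ⧸ P)
  have hqn : n + S.card ≤ q + S.card := by
    have h := hdim
    rw [hR, hq] at h
    exact_mod_cast h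
  -- the prime `Q = P/(S)` of the domain `D = R/(S)`
  haveI hQp : (P.map (Ideal.Quotient.mk (Ideal.span (S : Set R)))).IsPrime :=
    Ideal.isPrime_map_quotientMk_of_isPrime hSP
  have hdimQ : ringKrullDim ((R ⧸ Ideal.span (S : Set R)) ⧸
      P.map (Ideal.Quotient.mk (Ideal.span (S : Set R)))) = q := by
    rw [ringKrullDim_eq_of_ringEquiv (DoubleQuot.quotQuotEquivQuotOfLE hSP), hq]
  by_contra hne
  have hQne : P.map (Ideal.Quotient.mk (Ideal.span (S : Set R))) ≠ ⊥ := by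
    intro h
    rw [Ideal.map_eq_bot_iff_le_ker, Ideal.mk_ker] at h
    exact hne (le_antisymm h hSP)
  obtain ⟨x, hxQ, hx0⟩ := Submodule.exists_mem_ne_zero_of_ne_bot hQne
  have hxmax : x ∈ maximalIdeal (R ⧸ Ideal.span (S : Set R)) :=
    IsLocalRing.le_maximalIdeal hQp.ne_top' hxQ
  have hxreg : IsSMulRegular (R ⧸ Ideal.span (S : Set R)) x := IsSMulRegular.of_ne_zero hx0
  have h1 := ringKrullDim_quotient_span_singleton_succ_eq_ringKrullDim hxreg hxmax
  have hxQ' : Ideal.span {x} ≤ P.map (Ideal.Quotient.mk (Ideal.span (S : Set R))) := by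
    rw [Ideal.span_le, Set.singleton_subset_iff]; exact hxQ
  have h2 := ringKrullDim_le_of_surjective (Ideal.Quotient.factor hxQ')
    (Ideal.Quotient.factor_surjective hxQ')
  rw [hdimQ] at h2
  -- `q + 1 ≤ dim D/(x) + 1 = dim D = n`
  have h3 : (q : WithBot ℕ∞) + 1 ≤ n := by
    calc (q : WithBot ℕ∞) + 1 ≤ ringKrullDim ((R ⧸ Ideal.span (S : Set R)) ⧸ Ideal.span {x}) + 1 :=
          add_le_add h2 le_rfl
      _ = n := by rw [h1, hn]
  have h4 : q + 1 ≤ n := by exact_mod_cast h3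
  omega

/-! ### The Jacobian criterion -/

/-- **Jacobian criterion at a rational point (local form).** Let `I ⊆ P ⊆ 𝔪_y` with `P` prime,
`f_1, …, f_r ∈ I` with linearly independent gradients at `y`, and `dim A/P ≥ e` where
`r + e = m`. Then `I A_{𝔪_y} = P A_{𝔪_y}`, and `A_{𝔪_y} / I A_{𝔪_y}` is a regular local ring of
dimension `e` (`y` is a smooth point of `V(I)`, which coincides with `V(P)` near `y`).
Proof: `A_{𝔪_y}` is regular of dimension `m`; by the cotangent computation the `f_i` are part of
a regular system of parameters; `dim A_𝔪/P A_𝔪 = ht(𝔪/P) = dim A/P ≥ e` (localization commutes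
with quotients; maximal ideals of the affine domain `A/P` have height `dim A/P`); conclude by
`eq_span_of_isPrime_of_linearIndependent_toCotangent`. [cite: Hartshorne1977, Thm. I.5.1] -/
theorem map_eq_map_of_jacobian (y : Fin m → k) [h𝔪 : (RingHom.ker (MvPolynomial.eval y)).IsPrime]
    {r e : ℕ} (hre : r + e = m) {I P : Ideal (MvPolynomial (Fin m) k)} [hP : P.IsPrime]
    (hIP : I ≤ P) (hPy : P ≤ RingHom.ker (MvPolynomial.eval y))
    (f : Fin r → MvPolynomial (Fin m) k) (hfI : ∀ i, f i ∈ I)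
    (hjac : LinearIndependent k (fun i : Fin r => fun j : Fin m =>
      MvPolynomial.eval y (MvPolynomial.pderiv j (f i))))
    (hdim : (e : WithBot ℕ∞) ≤ ringKrullDim (MvPolynomial (Fin m) k ⧸ P)) :
    I.map (algebraMap (MvPolynomial (Fin m) k)
        (Localization.AtPrime (RingHom.ker (MvPolynomial.eval y)))) =
      P.map (algebraMap (MvPolynomial (Fin m) k)
        (Localization.AtPrime (RingHom.ker (MvPolynomial.eval y)))) ∧
    IsRegularLocalRing (Localization.AtPrime (RingHom.ker (MvPolynomial.eval y)) ⧸
      I.map (algebraMap (MvPolynomial (Fin m) k)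
        (Localization.AtPrime (RingHom.ker (MvPolynomial.eval y))))) ∧
    ringKrullDim (Localization.AtPrime (RingHom.ker (MvPolynomial.eval y)) ⧸
      I.map (algebraMap (MvPolynomial (Fin m) k)
        (Localization.AtPrime (RingHom.ker (MvPolynomial.eval y))))) = e := by
  classical
  set 𝔪 := RingHom.ker (MvPolynomial.eval y) with h𝔪def
  haveI h𝔪max : 𝔪.IsMaximal := ker_eval_isMaximal y
  have hfy : ∀ i, f i ∈ 𝔪 := fun i => hPy (hIP (hfI i))
  -- the images of the `f_i` in the regular local ring `A_𝔪`
  set S : Finset (Localization.AtPrime 𝔪) := Finset.univ.image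
    (fun i => algebraMap (MvPolynomial (Fin m) k) (Localization.AtPrime 𝔪) (f i)) with hSdef
  have hS : ∀ x, x ∈ S ↔
      ∃ i, algebraMap (MvPolynomial (Fin m) k) (Localization.AtPrime 𝔪) (f i) = x :=
    fun x => by simp [hSdef]
  have sub : (S : Set (Localization.AtPrime 𝔪)) ⊆ maximalIdeal (Localization.AtPrime 𝔪) := by
    intro x hx
    obtain ⟨i, rfl⟩ := (hS x).1 (Finset.mem_coe.1 hx)
    rw [SetLike.mem_coe, ← Localization.AtPrime.map_eq_maximalIdeal]
    exact Ideal.mem_map_of_mem _ (hfy i)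
  have hli := linearIndependent_toCotangent_of_jacobian y f hfy hjac hS sub
  -- `#S = r`
  have hinjA : Function.Injective
      (algebraMap (MvPolynomial (Fin m) k) (Localization.AtPrime 𝔪)) :=
    IsLocalization.injective (Localization.AtPrime 𝔪) (Ideal.primeCompl_le_nonZeroDivisors 𝔪)
  have hinjf : Function.Injective
      (fun i => algebraMap (MvPolynomial (Fin m) k) (Localization.AtPrime 𝔪) (f i)) := by
    intro i i' h
    have hff : f i = f i' := hinjA h
    apply hjac.injective
    change (fun j : Fin m => MvPolynomial.eval y (MvPolynomial.pderiv j (f i))) =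
      fun j : Fin m => MvPolynomial.eval y (MvPolynomial.pderiv j (f i'))
    rw [hff]
  have hcard : S.card = r := by
    rw [hSdef, Finset.card_image_of_injective _ hinjf, Finset.card_univ, Fintype.card_fin]
  -- `dim A_𝔪 = m`
  have hdimR : ringKrullDim (Localization.AtPrime 𝔪) = (m : WithBot ℕ∞) := by
    rw [IsLocalization.AtPrime.ringKrullDim_eq_height 𝔪 (Localization.AtPrime 𝔪),
      Literature.AlgebraicGeometry.Resolution.MvPolynomial.height_eq_of_isMaximal k m 𝔪]
    norm_cast
  -- `P A_𝔪` is prime and `(f) ⊆ I A_𝔪 ⊆ P A_𝔪`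
  have hdisj : Disjoint (𝔪.primeCompl : Set (MvPolynomial (Fin m) k))
      (P : Set (MvPolynomial (Fin m) k)) :=
    Set.disjoint_left.2 fun x hx hxP => hx (hPy hxP)
  haveI hP' : (P.map (algebraMap (MvPolynomial (Fin m) k) (Localization.AtPrime 𝔪))).IsPrime :=
    IsLocalization.isPrime_of_isPrime_disjoint 𝔪.primeCompl _ P hP hdisj
  have hSI : Ideal.span (S : Set (Localization.AtPrime 𝔪)) ≤
      I.map (algebraMap (MvPolynomial (Fin m) k) (Localization.AtPrime 𝔪)) := by
    rw [Ideal.span_le]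
    intro x hx
    obtain ⟨i, rfl⟩ := (hS x).1 (Finset.mem_coe.1 hx)
    exact Ideal.mem_map_of_mem _ (hfI i)
  have hIP' : I.map (algebraMap (MvPolynomial (Fin m) k) (Localization.AtPrime 𝔪)) ≤
      P.map (algebraMap (MvPolynomial (Fin m) k) (Localization.AtPrime 𝔪)) := Ideal.map_mono hIP
  -- `dim A_𝔪/P A_𝔪 = ht(𝔪/P) = dim A/P ≥ e`
  have hdimP' : (e : WithBot ℕ∞) ≤ ringKrullDim (Localization.AtPrime 𝔪 ⧸
      P.map (algebraMap (MvPolynomial (Fin m) k) (Localization.AtPrime 𝔪))) := by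
    rw [Literature.AlgebraicGeometry.Resolution.ringKrullDim_localization_quotient_map_eq_height hPy]
    haveI : (𝔪.map (Ideal.Quotient.mk P)).IsPrime := Ideal.isPrime_map_quotientMk_of_isPrime hPy
    haveI : (𝔪.map (Ideal.Quotient.mk P)).IsMaximal :=
      (Ideal.map_eq_top_or_isMaximal_of_surjective (Ideal.Quotient.mk P)
        Ideal.Quotient.mk_surjective h𝔪max).resolve_left Ideal.IsPrime.ne_top'
    rw [Literature.AlgebraicGeometry.Resolution.height_eq_ringKrullDim_of_isMaximal k
      (𝔪.map (Ideal.Quotient.mk P))]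
    exact hdim
  have hdim' : ringKrullDim (Localization.AtPrime 𝔪) ≤ ringKrullDim (Localization.AtPrime 𝔪 ⧸
      P.map (algebraMap (MvPolynomial (Fin m) k) (Localization.AtPrime 𝔪))) + S.card := by
    rw [hdimR, hcard]
    calc (m : WithBot ℕ∞) = (e : WithBot ℕ∞) + (r : ℕ) := by rw [← hre, Nat.cast_add, add_comm]
      _ ≤ _ := add_le_add hdimP' le_rfl
  obtain ⟨hPS, hreg, hdimS⟩ := eq_span_of_isPrime_of_linearIndependent_toCotangent S sub hli
    (hSI.trans hIP') hdim'
  -- conclusion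
  have hIeq : I.map (algebraMap (MvPolynomial (Fin m) k) (Localization.AtPrime 𝔪)) =
      P.map (algebraMap (MvPolynomial (Fin m) k) (Localization.AtPrime 𝔪)) :=
    le_antisymm hIP' (hPS.le.trans hSI)
  have hSeq : Ideal.span (S : Set (Localization.AtPrime 𝔪)) =
      I.map (algebraMap (MvPolynomial (Fin m) k) (Localization.AtPrime 𝔪)) :=
    le_antisymm hSI (hIP'.trans hPS.le)
  refine ⟨hIeq, ?_, ?_⟩
  · rw [← hSeq]; exact hreg
  · haveI := hreg
    obtain ⟨n, hn⟩ := Literature.AlgebraicGeometry.Resolution.ringKrullDim_eq_nat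
      (Localization.AtPrime 𝔪 ⧸ Ideal.span (S : Set (Localization.AtPrime 𝔪)))
    have hne : n = e := by
      have h := hdimS
      rw [hn, hcard, hdimR] at h
      norm_cast at h
      omega
    rw [← hSeq, hn, hne]

/-- **Jacobian criterion ⇒ the point lies on exactly one irreducible component.** Under the
hypotheses of `map_eq_map_of_jacobian` (`I ⊆ P ⊆ 𝔪_y`, `P` prime with `dim A/P ≥ m - r`, and
`r` elements of `I` with independent gradients at `y`), exactly one minimal prime of `I` is
contained in `𝔪_y = ker (ev_y)` — the local ring `A_{𝔪_y}/I A_{𝔪_y}` is regular, hence a domain.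
[cite: Hartshorne1977, Thm. I.5.1] -/
theorem existsUnique_minimalPrimes_le_of_jacobian (y : Fin m → k) {r e : ℕ} (hre : r + e = m)
    {I P : Ideal (MvPolynomial (Fin m) k)} [hP : P.IsPrime]
    (hIP : I ≤ P) (hPy : P ≤ RingHom.ker (MvPolynomial.eval y))
    (f : Fin r → MvPolynomial (Fin m) k) (hfI : ∀ i, f i ∈ I)
    (hjac : LinearIndependent k (fun i : Fin r => fun j : Fin m =>
      MvPolynomial.eval y (MvPolynomial.pderiv j (f i))))
    (hdim : (e : WithBot ℕ∞) ≤ ringKrullDim (MvPolynomial (Fin m) k ⧸ P)) :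
    ∃! Q : Ideal (MvPolynomial (Fin m) k),
      Q ∈ I.minimalPrimes ∧ Q ≤ RingHom.ker (MvPolynomial.eval y) := by
  haveI h𝔪 : (RingHom.ker (MvPolynomial.eval y)).IsPrime := RingHom.ker_isPrime _
  obtain ⟨-, hreg, -⟩ := map_eq_map_of_jacobian y hre hIP hPy f hfI hjac hdim
  haveI := hreg
  exact Literature.RingTheory.Localization.existsUnique_minimalPrimes_le_of_isDomain_quotient_map
    (A := Localization.AtPrime (RingHom.ker (MvPolynomial.eval y)))
    (RingHom.ker (MvPolynomial.eval y)) I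
    (Literature.AlgebraicGeometry.Resolution.isDomain_of_isRegularLocalRing _)

/-- Under the same hypotheses, **`P` is a minimal prime of `I`** (the unique one inside `𝔪_y`):
`I A_𝔪 = P A_𝔪`, and primes inside `𝔪_y` are determined by their extensions to `A_𝔪`.
[cite: Hartshorne1977, Thm. I.5.1] -/
theorem mem_minimalPrimes_of_jacobian (y : Fin m → k) {r e : ℕ} (hre : r + e = m)
    {I P : Ideal (MvPolynomial (Fin m) k)} [hP : P.IsPrime]
    (hIP : I ≤ P) (hPy : P ≤ RingHom.ker (MvPolynomial.eval y))
    (f : Fin r → MvPolynomial (Fin m) k) (hfI : ∀ i, f i ∈ I)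
    (hjac : LinearIndependent k (fun i : Fin r => fun j : Fin m =>
      MvPolynomial.eval y (MvPolynomial.pderiv j (f i))))
    (hdim : (e : WithBot ℕ∞) ≤ ringKrullDim (MvPolynomial (Fin m) k ⧸ P)) :
    P ∈ I.minimalPrimes := by
  haveI h𝔪 : (RingHom.ker (MvPolynomial.eval y)).IsPrime := RingHom.ker_isPrime _
  obtain ⟨hIeq, -, -⟩ := map_eq_map_of_jacobian y hre hIP hPy f hfI hjac hdim
  refine ⟨⟨hP, hIP⟩, fun q ⟨hq, hIq⟩ hqP => ?_⟩
  -- `P = (P A_𝔪) ∩ A ≤ (q A_𝔪) ∩ A = q`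
  have hdisj : ∀ J : Ideal (MvPolynomial (Fin m) k), J ≤ RingHom.ker (MvPolynomial.eval y) →
      Disjoint ((RingHom.ker (MvPolynomial.eval y)).primeCompl : Set (MvPolynomial (Fin m) k))
        (J : Set (MvPolynomial (Fin m) k)) :=
    fun J hJ => Set.disjoint_left.2 fun x hx hxJ => hx (hJ hxJ)
  have hP' := IsLocalization.under_map_of_isPrime_disjoint
    (RingHom.ker (MvPolynomial.eval y)).primeCompl
    (Localization.AtPrime (RingHom.ker (MvPolynomial.eval y))) hP (hdisj P hPy)
  have hq' := IsLocalization.under_map_of_isPrime_disjoint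
    (RingHom.ker (MvPolynomial.eval y)).primeCompl
    (Localization.AtPrime (RingHom.ker (MvPolynomial.eval y))) hq (hdisj q (hqP.trans hPy))
  rw [← hP', ← hq', Ideal.under_def, Ideal.under_def, ← hIeq]
  exact Ideal.comap_mono (Ideal.map_mono hIq)

/-- The same unique-component statement with the point ideal written as the kernel of
`MvPolynomial.aeval y` (the form used for constants varieties of circuits; definitionally the
kernel of `MvPolynomial.eval y`). [cite: Hartshorne1977, Thm. I.5.1] -/
theorem existsUnique_minimalPrimes_le_ker_aeval_of_jacobian (y : Fin m → k) {r e : ℕ}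
    (hre : r + e = m) {I P : Ideal (MvPolynomial (Fin m) k)} [hP : P.IsPrime]
    (hIP : I ≤ P) (hPy : P ≤ RingHom.ker (MvPolynomial.aeval y : MvPolynomial (Fin m) k →ₐ[k] k))
    (f : Fin r → MvPolynomial (Fin m) k) (hfI : ∀ i, f i ∈ I)
    (hjac : LinearIndependent k (fun i : Fin r => fun j : Fin m =>
      MvPolynomial.aeval y (MvPolynomial.pderiv j (f i))))
    (hdim : (e : WithBot ℕ∞) ≤ ringKrullDim (MvPolynomial (Fin m) k ⧸ P)) :
    ∃! Q : Ideal (MvPolynomial (Fin m) k), Q ∈ I.minimalPrimes ∧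
      Q ≤ RingHom.ker (MvPolynomial.aeval y : MvPolynomial (Fin m) k →ₐ[k] k) :=
  existsUnique_minimalPrimes_le_of_jacobian y hre hIP hPy f hfI hjac hdim

end Literature.RingTheory.MvPolynomial

end
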